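import Mathlib
import Summits.AtomisticToContinuum.HydrodynamicLimit.Theorems.InformationPercolationEngineKickFairRelEquilibriumMesoConditionThePastDefs
import Summits.AtomisticToContinuum.HydrodynamicLimit.Theorems.InformationPercolationEngineKickFairRelEquilibriumMesoUnorderedPairCount
import Summits.AtomisticToContinuum.HydrodynamicLimit.Theorems.InformationPercolationEngineKickFairRelEquilibriumMesoCountExcessLGConst
import Literature.MathematicalPhysics.KineticTheory.LocalGibbsConstEquivalence
import Literature.MathematicalPhysics.KineticTheory.EvenStatTruncationBound
import HarnessLib

/-!
# `KickFairRelEquilibriumMeso`, line `condition-the-past` — CT-b (`UnorderedPairWeight`) ⇐ CT-a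
# (`CountExcessLG`) exactly, and CT-b at RUNG 0

Prover file (`--supports stmt-AtomisticToContinuum-15177`) of the checked skeleton
`Cruxes/KickFairRelEquilibriumMeso/Lines/condition_the_past.lean` (rev 2, lead c7), stub CT-b
`stub_unorderedPairWeight : UnorderedPairWeight rs`. By the pathwise count of `…MesoUnorderedPairCount`
(`unorderedPairCount_le`: `#{unordered pairs} ≤ 8 (N+1) Σ_i cnt_i` on the good set, every mesh), the CT-b integrand
is dominated `LG`-a.e. (`localGibbsLaw_compl_good_eq_zero`) by `8 ε_N · (ε_N/(N+1)) Σ_i cnt_i`, and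
`cnt_i ≤ (cnt_i − A(N+1)^{1/3})₊ + A(N+1)^{1/3}`, `ε_N (N+1)^{1/3} = σ` give, under ANY local Gibbs probability law,

  `E_{LG}[(ε/(N+1))² #{unordered}] ≤ 8 ε_N · E_{LG}[(ε/(N+1)) Σ_i (cnt_i − A(N+1)^{1/3})₊] + 8 ε_N σ A`

(`lintegral_unorderedPair_le`). Since `ε_N = σ (N+1)^{-1/3} → 0`, any eventual bound `≤ δ/2` on the mean excess
(the conclusion of CT-a) makes the right side `≤ δ` eventually (`unorderedPair_eventually_of_countExcess`,
`σ₀ := min σ₀ (1/2)` for `isProbabilityMeasure_localGibbsLaw`, `N₀ := max`). Hence: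

* `unorderedPairWeight_of_countExcessLG : CountExcessLG → UnorderedPairWeight rseq` for EVERY mesh sequence `rseq` —
  the registered CT-b is implied by the registered CT-a (`stub_countExcessLG`; open for general profiles, the
  `LG`-native count input of `Lines/Sketch-dead.md` §4(1)); nothing here asserts CT-a;
* `unorderedPairWeight_const` — CT-b at constant profiles (the invariant canonical law), unconditionally, from the
  landed rung-0 CT-a `countExcessLG_const` (p148642; windowing + the first-moment collision-flux bound).

So CT-b is not a second-moment ("pairs of collisions close in time") statement: the only unordered pairs are a
record paired with the `≤ 4 (N+1)` records whose collision time lies in one of the two flights leading to it, counted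
from the side of the EARLIER record, and flights of one sphere do not overlap.
-/

noncomputable section

open MeasureTheory Set Filter Topology
open scoped ENNReal Classical

namespace Summit.AtomisticToContinuum.HydrodynamicLimit.Theorems.KickFairRelEquilibriumMesoLine

open Literature.Analysis.FluidPDE Literature.MathematicalPhysics.KineticTheory

variable {σ : ℝ} {N : ℕ}

/-! ## The `LG`-mean of the unordered-pair weight is `8 ε` times the normalised mean collision count -/

/-- `ε (N+1)^{1/3} = σ`. [folklore] -/
theorem hsDiameter_mul_rpow_third (σ : ℝ) (N : ℕ) : hsDiameter σ N * ((N : ℝ) + 1) ^ (1 / 3 : ℝ) = σ := by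
  have hn : (0 : ℝ) < (N : ℝ) + 1 := by positivity
  rw [hsDiameter, Nat.cast_succ, mul_assoc, ← Real.rpow_add hn]
  norm_num

/-- **The mean bound, under ANY local Gibbs law (probability, carrying the good set).** For every `A ≥ 0`,
`E_{LG}[(ε/(N+1))² #unordered pairs] ≤ 8ε · E_{LG}[(ε/(N+1)) Σ_i (cnt_i − A(N+1)^{1/3})₊] + 8 ε σ A`
(`unorderedPairCount_le` on the good set, `cnt_i ≤ (cnt_i − A(N+1)^{1/3})₊ + A(N+1)^{1/3}`, `ε (N+1)^{1/3} = σ`).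
[folklore] -/
theorem lintegral_unorderedPair_le (a₀ θ₀ : T3 → ℝ) (u₀ : T3 → V3) (hσ : 0 < σ) (Φ : Flow σ N) (τ r : ℝ)
    {A : ℝ} (hA : 0 ≤ A) [IsProbabilityMeasure (localGibbsLaw σ a₀ u₀ θ₀ N Φ)] :
    ∫⁻ z, ENNReal.ofReal ((hsDiameter σ N / ((N : ℝ) + 1)) ^ 2 *
        ∑ i : Fin (N + 1), ∑ n ∈ Finset.range (cnt Φ τ z i),
          ∑ i' : Fin (N + 1), ∑ n' ∈ Finset.range (cnt Φ τ z i'),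
            (if ¬ Precedes (past Φ r z i n) (past Φ r z i' n') ∧ ¬ Precedes (past Φ r z i' n') (past Φ r z i n)
              then (1 : ℝ) else 0)) ∂(localGibbsLaw σ a₀ u₀ θ₀ N Φ) ≤
      ENNReal.ofReal (8 * hsDiameter σ N) *
          ∫⁻ z, ENNReal.ofReal (hsDiameter σ N / ((N : ℝ) + 1) *
            ∑ i : Fin (N + 1), max ((cnt Φ τ z i : ℝ) - A * ((N : ℝ) + 1) ^ (1 / 3 : ℝ)) 0)
            ∂(localGibbsLaw σ a₀ u₀ θ₀ N Φ) +
        ENNReal.ofReal (8 * hsDiameter σ N * (σ * A)) := by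
  set P := localGibbsLaw σ a₀ u₀ θ₀ N Φ with hP
  have hε0 : 0 < hsDiameter σ N := hsDiameter_pos hσ N
  have hn : (0 : ℝ) < (N : ℝ) + 1 := by positivity
  have hae : ∀ᵐ z ∂P, z ∈ Φ.good := by
    rw [ae_iff]
    exact localGibbsLaw_compl_good_eq_zero Φ
  have hexc0 : ∀ z : Phase N, 0 ≤ hsDiameter σ N / ((N : ℝ) + 1) *
      ∑ i : Fin (N + 1), max ((cnt Φ τ z i : ℝ) - A * ((N : ℝ) + 1) ^ (1 / 3 : ℝ)) 0 := fun z =>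
    mul_nonneg (by positivity) (Finset.sum_nonneg fun i _ => le_max_right _ _)
  -- pathwise domination on the good set
  have hdom : ∀ z ∈ Φ.good, ENNReal.ofReal ((hsDiameter σ N / ((N : ℝ) + 1)) ^ 2 *
      ∑ i : Fin (N + 1), ∑ n ∈ Finset.range (cnt Φ τ z i),
        ∑ i' : Fin (N + 1), ∑ n' ∈ Finset.range (cnt Φ τ z i'),
          (if ¬ Precedes (past Φ r z i n) (past Φ r z i' n') ∧ ¬ Precedes (past Φ r z i' n') (past Φ r z i n)
            then (1 : ℝ) else 0)) ≤
      ENNReal.ofReal (8 * hsDiameter σ N) * ENNReal.ofReal (hsDiameter σ N / ((N : ℝ) + 1) *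
          ∑ i : Fin (N + 1), max ((cnt Φ τ z i : ℝ) - A * ((N : ℝ) + 1) ^ (1 / 3 : ℝ)) 0) +
        ENNReal.ofReal (8 * hsDiameter σ N * (σ * A)) := by
    intro z hz
    rw [← ENNReal.ofReal_mul (by positivity), ← ENNReal.ofReal_add (mul_nonneg (by positivity) (hexc0 z))
      (by positivity)]
    refine ENNReal.ofReal_le_ofReal ?_
    have hU := unorderedPairCount_le_of_mem_good Φ τ r hz
    -- `cnt_i ≤ (cnt_i − A P)₊ + A P`, summed and normalised: `(ε/(N+1)) Σ cnt ≤ excess + σ A`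
    have hK : hsDiameter σ N / ((N : ℝ) + 1) * ∑ i : Fin (N + 1), (cnt Φ τ z i : ℝ) ≤
        hsDiameter σ N / ((N : ℝ) + 1) *
            ∑ i : Fin (N + 1), max ((cnt Φ τ z i : ℝ) - A * ((N : ℝ) + 1) ^ (1 / 3 : ℝ)) 0 + σ * A := by
      have hi : ∀ i : Fin (N + 1), (cnt Φ τ z i : ℝ) ≤
          max ((cnt Φ τ z i : ℝ) - A * ((N : ℝ) + 1) ^ (1 / 3 : ℝ)) 0 + A * ((N : ℝ) + 1) ^ (1 / 3 : ℝ) :=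
        fun i => by
          have := le_max_left ((cnt Φ τ z i : ℝ) - A * ((N : ℝ) + 1) ^ (1 / 3 : ℝ)) 0
          linarith
      have hmul : hsDiameter σ N / ((N : ℝ) + 1) * (((N : ℝ) + 1) * (A * ((N : ℝ) + 1) ^ (1 / 3 : ℝ))) =
          hsDiameter σ N * ((N : ℝ) + 1) ^ (1 / 3 : ℝ) * A := by
        field_simp
      calc hsDiameter σ N / ((N : ℝ) + 1) * ∑ i : Fin (N + 1), (cnt Φ τ z i : ℝ)
          ≤ hsDiameter σ N / ((N : ℝ) + 1) * ∑ i : Fin (N + 1),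
              (max ((cnt Φ τ z i : ℝ) - A * ((N : ℝ) + 1) ^ (1 / 3 : ℝ)) 0 + A * ((N : ℝ) + 1) ^ (1 / 3 : ℝ)) :=
            mul_le_mul_of_nonneg_left (Finset.sum_le_sum fun i _ => hi i) (by positivity)
        _ = hsDiameter σ N / ((N : ℝ) + 1) *
              ∑ i : Fin (N + 1), max ((cnt Φ τ z i : ℝ) - A * ((N : ℝ) + 1) ^ (1 / 3 : ℝ)) 0 +
            hsDiameter σ N / ((N : ℝ) + 1) * (((N : ℝ) + 1) * (A * ((N : ℝ) + 1) ^ (1 / 3 : ℝ))) := by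
            rw [Finset.sum_add_distrib, mul_add, Finset.sum_const, Finset.card_univ, Fintype.card_fin, nsmul_eq_mul]
            push_cast
            ring
        _ = _ := by rw [hmul, hsDiameter_mul_rpow_third]
    calc (hsDiameter σ N / ((N : ℝ) + 1)) ^ 2 *
          ∑ i : Fin (N + 1), ∑ n ∈ Finset.range (cnt Φ τ z i),
            ∑ i' : Fin (N + 1), ∑ n' ∈ Finset.range (cnt Φ τ z i'),
              (if ¬ Precedes (past Φ r z i n) (past Φ r z i' n') ∧ ¬ Precedes (past Φ r z i' n') (past Φ r z i n)
                then (1 : ℝ) else 0)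
        ≤ (hsDiameter σ N / ((N : ℝ) + 1)) ^ 2 * (8 * ((N : ℝ) + 1) * ∑ i : Fin (N + 1), (cnt Φ τ z i : ℝ)) :=
          mul_le_mul_of_nonneg_left hU (sq_nonneg _)
      _ = 8 * hsDiameter σ N * (hsDiameter σ N / ((N : ℝ) + 1) * ∑ i : Fin (N + 1), (cnt Φ τ z i : ℝ)) := by
          field_simp
      _ ≤ 8 * hsDiameter σ N * (hsDiameter σ N / ((N : ℝ) + 1) *
            ∑ i : Fin (N + 1), max ((cnt Φ τ z i : ℝ) - A * ((N : ℝ) + 1) ^ (1 / 3 : ℝ)) 0 + σ * A) :=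
          mul_le_mul_of_nonneg_left hK (by positivity)
      _ = _ := by ring
  calc ∫⁻ z, ENNReal.ofReal ((hsDiameter σ N / ((N : ℝ) + 1)) ^ 2 *
        ∑ i : Fin (N + 1), ∑ n ∈ Finset.range (cnt Φ τ z i),
          ∑ i' : Fin (N + 1), ∑ n' ∈ Finset.range (cnt Φ τ z i'),
            (if ¬ Precedes (past Φ r z i n) (past Φ r z i' n') ∧ ¬ Precedes (past Φ r z i' n') (past Φ r z i n)
              then (1 : ℝ) else 0)) ∂P
      ≤ ∫⁻ z, (ENNReal.ofReal (8 * hsDiameter σ N) * ENNReal.ofReal (hsDiameter σ N / ((N : ℝ) + 1) *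
            ∑ i : Fin (N + 1), max ((cnt Φ τ z i : ℝ) - A * ((N : ℝ) + 1) ^ (1 / 3 : ℝ)) 0) +
          ENNReal.ofReal (8 * hsDiameter σ N * (σ * A))) ∂P :=
        lintegral_mono_ae (by filter_upwards [hae] with z hz using hdom z hz)
    _ = ENNReal.ofReal (8 * hsDiameter σ N) * ∫⁻ z, ENNReal.ofReal (hsDiameter σ N / ((N : ℝ) + 1) *
            ∑ i : Fin (N + 1), max ((cnt Φ τ z i : ℝ) - A * ((N : ℝ) + 1) ^ (1 / 3 : ℝ)) 0) ∂P +
          ENNReal.ofReal (8 * hsDiameter σ N * (σ * A)) := by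
        rw [lintegral_add_right _ measurable_const, lintegral_const_mul' _ _ ENNReal.ofReal_ne_top,
          lintegral_const, measure_univ, mul_one]

/-- **CT-b from a CT-a-type mean-excess bound, profile by profile.** If the local Gibbs laws of the profiles are
probability measures for `σ ≤ 1/2` and the normalised mean EXCESS of the collision counts over `A (N+1)^{1/3}` is
eventually `≤ δ` (the conclusion of `CountExcessLG` for these profiles, below `σ₀`), then below `min σ₀ (1/2)` the
`LG`-mean of `(ε/(N+1))² #unordered pairs` is eventually `≤ δ`, for EVERY mesh sequence: apply the mean bound at
`δ/2` and wait until `8 ε_N ≤ 1` and `8 ε_N σ A ≤ δ/2` (`ε_N = σ (N+1)^{-1/3} → 0`). [folklore] -/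
theorem unorderedPair_eventually_of_countExcess (a₀ θ₀ : T3 → ℝ) (u₀ : T3 → V3)
    (hprob : ∀ σ : ℝ, σ ≤ 1 / 2 → ∀ N : ℕ, ∀ Φ : Flow σ N, IsProbabilityMeasure (localGibbsLaw σ a₀ u₀ θ₀ N Φ))
    {σ₀ : ℝ} (hCT : ∀ σ : ℝ, 0 < σ → σ < σ₀ → ∀ Φ : (N : ℕ) → Flow σ N, ∀ τ : ℝ, 0 < τ →
      ∀ δ : ℝ, 0 < δ → ∃ A : ℝ, 0 < A ∧ ∃ N₀ : ℕ, ∀ N : ℕ, N₀ ≤ N →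
      ∫⁻ z, ENNReal.ofReal (hsDiameter σ N / ((N : ℝ) + 1) *
        ∑ i : Fin (N + 1), max ((cnt (Φ N) τ z i : ℝ) - A * ((N : ℝ) + 1) ^ (1 / 3 : ℝ)) 0)
        ∂(localGibbsLaw σ a₀ u₀ θ₀ N (Φ N)) ≤ ENNReal.ofReal δ) (rseq : ℕ → ℝ) :
    ∀ σ : ℝ, 0 < σ → σ < min σ₀ (1 / 2) → ∀ Φ : (N : ℕ) → Flow σ N, ∀ τ : ℝ, 0 < τ →
      ∀ δ : ℝ, 0 < δ → ∃ N₀ : ℕ, ∀ N : ℕ, N₀ ≤ N →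
      ∫⁻ z, ENNReal.ofReal ((hsDiameter σ N / ((N : ℝ) + 1)) ^ 2 *
        ∑ i : Fin (N + 1), ∑ n ∈ Finset.range (cnt (Φ N) τ z i),
          ∑ i' : Fin (N + 1), ∑ n' ∈ Finset.range (cnt (Φ N) τ z i'),
            (if ¬ Precedes (past (Φ N) (rseq N) z i n) (past (Φ N) (rseq N) z i' n') ∧
                ¬ Precedes (past (Φ N) (rseq N) z i' n') (past (Φ N) (rseq N) z i n) then (1 : ℝ) else 0))
        ∂(localGibbsLaw σ a₀ u₀ θ₀ N (Φ N)) ≤ ENNReal.ofReal δ := by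
  intro σ hσ hσlt Φ τ hτ δ hδ
  have hσ₀ : σ < σ₀ := hσlt.trans_le (min_le_left _ _)
  have hσ2 : σ ≤ 1 / 2 := (hσlt.trans_le (min_le_right _ _)).le
  obtain ⟨A, hA, N₀, hN₀⟩ := hCT σ hσ hσ₀ Φ τ hτ (δ / 2) (half_pos hδ)
  -- `ε_N → 0`: eventually `ε_N ≤ min (1/8) (δ / (16 σ A))`
  obtain ⟨N₁, hN₁⟩ : ∃ N₁ : ℕ, ∀ N, N₁ ≤ N → hsDiameter σ N ≤ min (1 / 8) (δ / (16 * σ * A)) := by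
    have h1 : Tendsto (fun N : ℕ => ((N : ℝ) + 1)) atTop atTop :=
      tendsto_atTop_add_const_right _ 1 tendsto_natCast_atTop_atTop
    have h2 := ((tendsto_rpow_neg_atTop (show (0 : ℝ) < 1 / 3 by norm_num)).comp h1).const_mul σ
    rw [mul_zero] at h2
    have h3 : Tendsto (fun N : ℕ => hsDiameter σ N) atTop (𝓝 0) := by
      refine h2.congr fun N => ?_
      simp [hsDiameter, Function.comp, Nat.cast_succ]
    have hpos : (0 : ℝ) < min (1 / 8) (δ / (16 * σ * A)) := lt_min (by norm_num) (by positivity)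
    exact eventually_atTop.1 (h3.eventually (Iic_mem_nhds hpos))
  refine ⟨max N₀ N₁, fun N hN => ?_⟩
  have hN0 : N₀ ≤ N := le_of_max_le_left hN
  have hN1 : N₁ ≤ N := le_of_max_le_right hN
  haveI := hprob σ hσ2 N (Φ N)
  have hε := hN₁ N hN1
  have hε8 : 8 * hsDiameter σ N ≤ 1 := by linarith [hε.trans (min_le_left _ _)]
  have hεA : 8 * hsDiameter σ N * (σ * A) ≤ δ / 2 := by
    have h := hε.trans (min_le_right _ _)
    rw [le_div_iff₀ (by positivity)] at h
    rw [show 8 * hsDiameter σ N * (σ * A) = hsDiameter σ N * (16 * σ * A) / 2 by ring]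
    linarith
  calc _ ≤ ENNReal.ofReal (8 * hsDiameter σ N) *
          ∫⁻ z, ENNReal.ofReal (hsDiameter σ N / ((N : ℝ) + 1) *
            ∑ i : Fin (N + 1), max ((cnt (Φ N) τ z i : ℝ) - A * ((N : ℝ) + 1) ^ (1 / 3 : ℝ)) 0)
            ∂(localGibbsLaw σ a₀ u₀ θ₀ N (Φ N)) +
        ENNReal.ofReal (8 * hsDiameter σ N * (σ * A)) :=
        lintegral_unorderedPair_le a₀ θ₀ u₀ hσ (Φ N) τ (rseq N) hA.le
    _ ≤ ENNReal.ofReal (8 * hsDiameter σ N) * ENNReal.ofReal (δ / 2) + ENNReal.ofReal (δ / 2) :=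
        add_le_add (mul_le_mul_right (hN₀ N hN0) _) (ENNReal.ofReal_le_ofReal hεA)
    _ ≤ 1 * ENNReal.ofReal (δ / 2) + ENNReal.ofReal (δ / 2) := by
        gcongr
        calc ENNReal.ofReal (8 * hsDiameter σ N) ≤ ENNReal.ofReal 1 := ENNReal.ofReal_le_ofReal hε8
          _ = 1 := ENNReal.ofReal_one
    _ = ENNReal.ofReal δ := by
        rw [one_mul, ← ENNReal.ofReal_add (by positivity) (by positivity), add_halves]

/-! ## CT-b ⇐ CT-a (general profiles), and CT-b at rung 0 -/

/-- **The exact reduction CT-b ⇐ CT-a (every mesh sequence).** `CountExcessLG → UnorderedPairWeight rseq`: the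
number of unordered kick pairs is at most `8 (N+1) Σ_i cnt_i` pathwise on the good set (`unorderedPairCount_le`), so
its `(ε/(N+1))²`-weight has `LG`-mean `≤ 8 ε_N (E_{LG}[excess] + σ A) → 0`. In particular the registered stub
`stub_unorderedPairWeight : UnorderedPairWeight rs` follows from the neighbour CT-a (`stub_countExcessLG`), with
`σ₀ := min σ₀(CT-a) (1/2)`. Nothing here asserts CT-a. [folklore] -/
theorem unorderedPairWeight_of_countExcessLG : ∀ rseq : ℕ → ℝ, CountExcessLG → UnorderedPairWeight rseq := by
  intro rseq hCT a₀ θ₀ u₀ ha hθ hu ha0 hθ0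
  obtain ⟨σ₀, hσ₀, H⟩ := hCT a₀ θ₀ u₀ ha hθ hu ha0 hθ0
  exact ⟨min σ₀ (1 / 2), lt_min hσ₀ (by norm_num), unorderedPair_eventually_of_countExcess a₀ θ₀ u₀
    (fun σ hσ2 N Φ => isProbabilityMeasure_localGibbsLaw ha hθ hu ha0 hθ0 hσ2 N Φ) H rseq⟩

/-- **CT-b at RUNG 0 (constant profiles = the invariant canonical law), every mesh sequence.** For constant
profiles `a, θ > 0`, `u`: `∃ σ₀ ∀ σ < σ₀ ∀ Φ τ δ ∃ N₀ ∀ N ≥ N₀`,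
`E[(ε/(N+1))² #{unordered pairs of counted kick records}] ≤ δ` under the local Gibbs law with constant profiles —
from the landed rung-0 CT-a `countExcessLG_const` (windowing + the first-moment collision-flux bound
`shortFlightLG_rung0`) by the pathwise count. [folklore] -/
theorem unorderedPairWeight_const : ∀ (rseq : ℕ → ℝ) (a θ : ℝ) (u : V3), 0 < a → 0 < θ → ∃ σ₀ : ℝ, 0 < σ₀ ∧ ∀ σ : ℝ, 0 < σ → σ < σ₀ → ∀ Φ : (N : ℕ) → Flow σ N, ∀ τ : ℝ, 0 < τ → ∀ δ : ℝ, 0 < δ → ∃ N₀ : ℕ, ∀ N : ℕ, N₀ ≤ N → ∫⁻ z, ENNReal.ofReal ((hsDiameter σ N / ((N : ℝ) + 1)) ^ 2 * ∑ i : Fin (N + 1), ∑ n ∈ Finset.range (cnt (Φ N) τ z i), ∑ i' : Fin (N + 1), ∑ n' ∈ Finset.range (cnt (Φ N) τ z i'), (if ¬ Precedes (past (Φ N) (rseq N) z i n) (past (Φ N) (rseq N) z i' n') ∧ ¬ Precedes (past (Φ N) (rseq N) z i' n') (past (Φ N) (rseq N) z i n) then (1 : ℝ) else 0)) ∂(localGibbsLaw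 σ (fun _ => a) (fun _ => u) (fun _ => θ) N (Φ N)) ≤ ENNReal.ofReal δ := by
  intro rseq a θ u ha hθ
  obtain ⟨σ₀, hσ₀, H⟩ := countExcessLG_const a θ u ha hθ
  exact ⟨min σ₀ (1 / 2), lt_min hσ₀ (by norm_num),
    unorderedPair_eventually_of_countExcess (fun _ => a) (fun _ => θ) (fun _ => u)
      (fun σ hσ2 N Φ => isProbabilityMeasure_localGibbsLaw continuous_const continuous_const continuous_const
        (fun _ => ha) (fun _ => hθ) hσ2 N Φ) H rseq⟩

end Summit.AtomisticToContinuum.HydrodynamicLimit.Theorems.KickFairRelEquilibriumMesoLine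

end
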